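import Literature.Combinatorics.Optimization.DualConeBlockPsdLifts
import Mathlib.Analysis.Normed.Affine.AddTorsorBases
import Mathlib.LinearAlgebra.Basis.VectorSpace
import HarnessLib

/-!
# `sxd(C^*) = sxd(C)` for EVERY closed convex cone (Averkov 2019, (2.2) with Remark 20's reduction)

G. Averkov, *Optimal size of linear matrix inequalities in semidefinite approaches to polynomial
optimization*, SIAM J. Appl. Algebra Geom. **3** (2019) = arXiv:1806.08656 [cite: Averkov2019] (held text
`paper:arxiv-1806.08656`; `pNN` = page of that text). Everything here is PROVED; no facts are asserted.

(2.2) (p06): "`sxd(C) = sxd(C^*)` … if `C ⊆ ℝ^n` is an `n`-dimensional pointed closed convex cone" — the tree's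
`hasBlockPsdLift_dualCone_iff` (`DualConeBlockPsdLifts.lean`; there with the same number of blocks, i.e. also
(2.1)). Remark 20 (p08): "We also sketch how to deduce the assertion … for general convex cones from the case
of `n`-dimensional pointed convex cones. If `C` is not full-dimensional or not pointed, then passing to
appropriate coordinates, we can assume `C = C_0 × ℝ^s × {0}^t`, where the cone `C_0` is … pointed. It is not
hard to see that `C` has a `K`-lift if and only if `C_0` has a `K`-lift. One has `C^* = C_0^* × {0}^s × ℝ^t`."

**This file carries out Remark 20 for `(S^d_+)^m`-lifts with `m` free**, giving (2.2) for every closed convex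
cone `C ⊆ ℝ^V` (`hasBlockPsdLift_dualCone_exists_iff`, `Averkov2019_sxd_dual`): `C^*` has an `(S^d_+)^m`-lift
for some `m` iff `C` has one for some `m` (`d ≥ 1`). Coordinate-free rendering of the splitting: `Lin = C ∩ (−C)`
(`lineality`), a linear complement `M` (`Submodule.exists_isCompl`), `C_1 = C ∩ M` (pointed; a section of
`C`), a basis of `W_1 = span C_1` giving `ι : ℝ^m ≅ W_1` and the pointed FULL-DIMENSIONAL cone
`K = ι⁻¹(C) ⊆ ℝ^m` (a linear image of `C_1`); the tree's theorem gives a lift of `K^*`; and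
`C^* = (ιᵀ)⁻¹(K^*) ∩ Lin^⊥` (`ιᵀ` the dot-product adjoint) is a preimage followed by a section. Preimages
cost a lift of the ambient space (`hasBlockPsdLift_preimage`, `hasBlockPsdLift_univ`: `ℝ^V = ℝ^V_+ − ℝ^V_+`,
`2|V|` blocks), which is why only the block SIZE is preserved: the same-`m` statement (2.1) is printed — and
true — only for pointed full-dimensional cones (in `ℝ¹`, `{0}^* = ℝ` has no `(S^1_+)^1`-lift while `{0}` has).
The functional form of pointedness the tree's theorem wants is derived from `K ∩ (−K) = {0}` through
`int K^* ≠ ∅` (else `K^*` lies in a hyperplane `v^⊥` and `±v ∈ K^{**} = K`).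
-/

noncomputable section

open Finset Matrix
open scoped Pointwise

namespace Literature.Combinatorics.Optimization

variable {V : Type*} [Fintype V]

namespace DualConeSxd

/-! ### §1 Generic `(S^d_+)^r`-lift lemmas: the orthant, the whole space, preimages -/

/-- The nonnegative orthant `ℝ^V_+` has an `(S^1_+)^{|V|}`-lift (LP lift by its `|V|` inequalities).
[cite: GouveiaParriloThomas2013, Def. 2.2 (§2)] -/
theorem hasBlockPsdLift_orthant_one : HasBlockPsdLift {x : V → ℝ | ∀ v, 0 ≤ x v} 1 (Fintype.card V) := by
  classical
  let e := Fintype.equivFin V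
  let π : (Fin (Fintype.card V) → Matrix (Fin 1) (Fin 1) ℝ) →ₗ[ℝ] (V → ℝ) :=
    { toFun := fun M v => M (e v) 0 0
      map_add' := fun _ _ => rfl
      map_smul' := fun _ _ => rfl }
  refine ⟨⊤, π, Set.ext fun x => ⟨fun hx => ?_, ?_⟩⟩
  · refine ⟨fun t => x (e.symm t) • (1 : Matrix (Fin 1) (Fin 1) ℝ),
      ⟨fun t => PosSemidef.one.smul (hx _), AffineSubspace.mem_top ℝ _ _⟩, ?_⟩
    funext v
    show (x (e.symm (e v)) • (1 : Matrix (Fin 1) (Fin 1) ℝ)) 0 0 = x v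
    simp
  · rintro ⟨M, ⟨hM, -⟩, rfl⟩ v
    exact (hM (e v)).diag_nonneg

/-- **The whole space `ℝ^V` has an `(S^d_+)^{2|V|}`-lift** for `d ≥ 1` (`ℝ^V = ℝ^V_+ + (−ℝ^V_+)`).
[cite: GouveiaParriloThomas2013, Def. 2.2 (§2)] [cite: Averkov2019, Remark 20 (p08, the factor `ℝ^s`)] -/
theorem hasBlockPsdLift_univ {d : ℕ} (hd : 1 ≤ d) :
    HasBlockPsdLift (Set.univ : Set (V → ℝ)) d (Fintype.card V + Fintype.card V) := by
  have hO := (hasBlockPsdLift_orthant_one (V := V)).mono_size hd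
  have h := hO.add (hO.image (-LinearMap.id))
  have hset : (Set.univ : Set (V → ℝ)) =
      {x : V → ℝ | ∀ v, 0 ≤ x v} + (-LinearMap.id : (V → ℝ) →ₗ[ℝ] (V → ℝ)) '' {x : V → ℝ | ∀ v, 0 ≤ x v} := by
    ext x
    simp only [Set.mem_univ, true_iff]
    refine Set.mem_add.2 ⟨fun v => max (x v) 0, fun v => le_max_right _ _, -(fun v => max (-x v) 0),
      ⟨fun v => max (-x v) 0, fun v => le_max_right _ _, by simp⟩, ?_⟩
    funext v
    simp only [Pi.add_apply, Pi.neg_apply]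
    rw [← sub_eq_add_neg, max_zero_sub_max_neg_zero_eq_self]
  rw [hset]
  exact h

/-- **Preimages**: if `T ⊆ F` has an `(S^d_+)^r`-lift and the ambient `E` an `(S^d_+)^{r'}`-lift, then
`f⁻¹(T)` has an `(S^d_+)^{r'+r}`-lift for every linear `f : E → F` (project `{(y, t) ∈ E × T : f y = t}`).
[cite: GouveiaParriloThomas2013, Def. 2.2 (§2)] [cite: Averkov2019, Remark 20 (p08)] -/
theorem hasBlockPsdLift_preimage {E F : Type*} [AddCommGroup E] [Module ℝ E] [AddCommGroup F] [Module ℝ F]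
    {T : Set F} {d r r' : ℕ} (hT : HasBlockPsdLift T d r) (f : E →ₗ[ℝ] F)
    (hE : HasBlockPsdLift (Set.univ : Set E) d r') : HasBlockPsdLift (f ⁻¹' T) d (r' + r) := by
  let g : E × F →ₗ[ℝ] F := f.comp (LinearMap.fst ℝ E F) - LinearMap.snd ℝ E F
  have h := ((hE.prod hT).inter_affineSubspace (LinearMap.ker g).toAffineSubspace).image (LinearMap.fst ℝ E F)
  have hset : f ⁻¹' T = LinearMap.fst ℝ E F ''
      ((Set.univ : Set E) ×ˢ T ∩ ((LinearMap.ker g).toAffineSubspace : Set (E × F))) := by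
    ext y
    constructor
    · intro hy
      refine ⟨(y, f y), ⟨⟨trivial, hy⟩, ?_⟩, rfl⟩
      show (y, f y) ∈ LinearMap.ker g
      rw [LinearMap.mem_ker]
      simp [g]
    · rintro ⟨⟨y', z⟩, ⟨⟨-, hz⟩, hker⟩, rfl⟩
      have hker' : (y', z) ∈ LinearMap.ker g := hker
      rw [LinearMap.mem_ker] at hker'
      have hz' : f y' = z := by
        have : f y' - z = 0 := by simpa [g] using hker'
        exact sub_eq_zero.1 this
      show f y' ∈ T
      rwa [hz']
  rw [hset]
  exact h

/-! ### §2 Dot-product plumbing: functionals, adjoints, the lineality space, orthogonal spaces -/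

/-- A linear functional on `ℝ^W` is the dot product with the vector of its values on the coordinate
vectors. [folklore] -/
private theorem linear_eq_dotProduct {W : Type*} [Fintype W] [DecidableEq W] (f : (W → ℝ) →ₗ[ℝ] ℝ)
    (x : W → ℝ) : f x = x ⬝ᵥ fun i => f (Pi.single i 1) := by
  conv_lhs => rw [show x = ∑ i, x i • (Pi.single i (1 : ℝ) : W → ℝ) from by
    funext j; simp [Finset.sum_apply, Pi.single_apply]]
  rw [map_sum]
  simp only [map_smul, smul_eq_mul, dotProduct]

/-- The dot-product adjoint `ιᵀ : ℝ^V → ℝ^m` of a linear map `ι : ℝ^m → ℝ^V`: `(ιᵀ y)_i = ⟨ι e_i, y⟩`.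
[cite: Averkov2019, Remark 20 (p08, "`⟨x, y⟩ = ⟨x_0, y_0⟩`")] -/
def adj {m : ℕ} (ι : (Fin m → ℝ) →ₗ[ℝ] (V → ℝ)) : (V → ℝ) →ₗ[ℝ] (Fin m → ℝ) where
  toFun y i := ι (Pi.single i 1) ⬝ᵥ y
  map_add' y z := by
    funext i
    simp only [dotProduct_add, Pi.add_apply]
  map_smul' c y := by
    funext i
    simp only [dotProduct_smul, smul_eq_mul, Pi.smul_apply, RingHom.id_apply]

/-- `⟨ι a, y⟩ = ⟨a, ιᵀ y⟩`. [cite: Averkov2019, Remark 20 (p08)] -/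
theorem dotProduct_adj {m : ℕ} (ι : (Fin m → ℝ) →ₗ[ℝ] (V → ℝ)) (a : Fin m → ℝ) (y : V → ℝ) :
    ι a ⬝ᵥ y = a ⬝ᵥ adj ι y := by
  have ha : a = ∑ i, a i • (Pi.single i (1 : ℝ) : Fin m → ℝ) := by
    funext j; simp [Finset.sum_apply, Pi.single_apply]
  conv_lhs => rw [ha]
  rw [map_sum]
  simp only [map_smul, dotProduct, adj, LinearMap.coe_mk, AddHom.coe_mk, Finset.sum_apply, Pi.smul_apply,
    smul_eq_mul, Finset.sum_mul, Finset.mul_sum]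
  rw [Finset.sum_comm]
  exact Finset.sum_congr rfl fun i _ => Finset.sum_congr rfl fun v _ => by ring

/-- **The lineality space** `C ∩ (−C)` of a convex cone (closed under `+`, containing `0`, closed under
nonnegative scaling), as a submodule. [cite: Averkov2019, Remark 20 (p08, "not pointed … `ℝ^s`")] -/
def lineality (C : Set (V → ℝ)) (hadd : ∀ x ∈ C, ∀ y ∈ C, x + y ∈ C) (h0 : (0 : V → ℝ) ∈ C)
    (hsmul : ∀ x ∈ C, ∀ t : ℝ, 0 ≤ t → t • x ∈ C) : Submodule ℝ (V → ℝ) where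
  carrier := {x | x ∈ C ∧ -x ∈ C}
  add_mem' := by
    rintro x y ⟨hx, hnx⟩ ⟨hy, hny⟩
    refine ⟨hadd x hx y hy, ?_⟩
    rw [neg_add]
    exact hadd _ hnx _ hny
  zero_mem' := ⟨h0, by rw [neg_zero]; exact h0⟩
  smul_mem' := by
    rintro c x ⟨hx, hnx⟩
    rcases le_total 0 c with hc | hc
    · refine ⟨hsmul x hx c hc, ?_⟩
      rw [← smul_neg]
      exact hsmul _ hnx c hc
    · have hc' : 0 ≤ -c := by linarith
      refine ⟨?_, ?_⟩
      · have h := hsmul _ hnx (-c) hc'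
        rwa [smul_neg, neg_smul, neg_neg] at h
      · have h := hsmul x hx (-c) hc'
        rwa [neg_smul] at h

omit [Fintype V] in
/-- Membership in the lineality space. [cite: Averkov2019, Remark 20 (p08)] -/
theorem mem_lineality {C : Set (V → ℝ)} {hadd : ∀ x ∈ C, ∀ y ∈ C, x + y ∈ C} {h0 : (0 : V → ℝ) ∈ C}
    {hsmul : ∀ x ∈ C, ∀ t : ℝ, 0 ≤ t → t • x ∈ C} {x : V → ℝ} :
    x ∈ lineality C hadd h0 hsmul ↔ x ∈ C ∧ -x ∈ C := Iff.rfl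

/-- The orthogonal space `S^⊥ = {y : ⟨s, y⟩ = 0 ∀ s ∈ S}` (dot product), as a submodule.
[cite: Averkov2019, Remark 20 (p08, "`C^* = C_0^* × {0}^s × ℝ^t`")] -/
def orth (S : Set (V → ℝ)) : Submodule ℝ (V → ℝ) where
  carrier := {y | ∀ s ∈ S, s ⬝ᵥ y = 0}
  add_mem' := by
    intro y z hy hz s hs
    rw [dotProduct_add, hy s hs, hz s hs, add_zero]
  zero_mem' := fun s _ => dotProduct_zero s
  smul_mem' := by
    intro c y hy s hs
    rw [dotProduct_smul, hy s hs, smul_zero]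

/-- Membership in `S^⊥`. [cite: Averkov2019, Remark 20 (p08)] -/
theorem mem_orth {S : Set (V → ℝ)} {y : V → ℝ} : y ∈ orth S ↔ ∀ s ∈ S, s ⬝ᵥ y = 0 := Iff.rfl

omit [Fintype V] in
/-- A convex set closed under nonnegative scaling is closed under addition. [folklore] -/
private theorem add_mem_of_convex_cone {C : Set (V → ℝ)} (hCconv : Convex ℝ C)
    (hCsmul : ∀ x ∈ C, ∀ t : ℝ, 0 ≤ t → t • x ∈ C) {x y : V → ℝ} (hx : x ∈ C) (hy : y ∈ C) : x + y ∈ C := by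
  have h := hCconv hx hy (by norm_num : (0 : ℝ) ≤ 1 / 2) (by norm_num : (0 : ℝ) ≤ 1 / 2) (by norm_num)
  have h2 := hCsmul _ h 2 (by norm_num)
  have : (2 : ℝ) • ((1 / 2 : ℝ) • x + (1 / 2 : ℝ) • y) = x + y := by
    rw [smul_add, smul_smul, smul_smul]; norm_num
  rwa [this] at h2

/-- **A closed convex cone with `K ∩ (−K) = {0}` is pointed by a functional**: some `u` has `⟨u, a⟩ ≥ 0` on
`K` with equality only at `a = 0`. (`K^*` has nonempty interior — otherwise `K^* ⊆ v^⊥` for some `v ≠ 0` and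
`±v ∈ K^{**} = K` — and an interior point of `K^*` is such a `u`, `dualCone_pointed_of_interior`.)
[cite: Averkov2019, §3.2 (p08, "`C` is pointed … then `{x ∈ C : ⟨u,x⟩ = 1}` is a bounded affine slice")] -/
theorem exists_pointing_of_pointed {W : Type*} [Fintype W] [DecidableEq W] {K : Set (W → ℝ)}
    (hKconv : Convex ℝ K) (hKclosed : IsClosed K) (hK0 : (0 : W → ℝ) ∈ K)
    (hKsmul : ∀ a ∈ K, ∀ t : ℝ, 0 ≤ t → t • a ∈ K) (hKpt : ∀ a ∈ K, -a ∈ K → a = 0) :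
    ∃ u : W → ℝ, (∀ a ∈ K, 0 ≤ u ⬝ᵥ a) ∧ ∀ a ∈ K, u ⬝ᵥ a = 0 → a = 0 := by
  have hDconv := convex_dualCone K
  have h0D : (0 : W → ℝ) ∈ dualCone K := fun a _ => by rw [dotProduct_zero]
  have hKK : dualCone (dualCone K) = K := dualCone_dualCone hKconv hKclosed hK0 hKsmul
  have hint : (interior (dualCone K)).Nonempty := by
    by_contra hemp
    rw [Set.not_nonempty_iff_eq_empty] at hemp
    have hne : affineSpan ℝ (dualCone K) ≠ ⊤ := fun htop => by
      have h := (hDconv.interior_nonempty_iff_affineSpan_eq_top).2 htop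
      rw [hemp] at h
      exact Set.not_nonempty_empty h
    have hvs : vectorSpan ℝ (dualCone K) ≠ ⊤ := fun h =>
      hne ((AffineSubspace.affineSpan_eq_top_iff_vectorSpan_eq_top_of_nonempty ℝ (W → ℝ) (W → ℝ) ⟨0, h0D⟩).2 h)
    obtain ⟨f, hf0, hle⟩ := Submodule.exists_le_ker_of_lt_top _ (lt_top_iff_ne_top.2 hvs)
    set v : W → ℝ := fun i => f (Pi.single i 1) with hv
    have hfv : ∀ y, f y = y ⬝ᵥ v := linear_eq_dotProduct f
    have hfD : ∀ y ∈ dualCone K, y ⬝ᵥ v = 0 := fun y hy => by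
      rw [← hfv]
      exact LinearMap.mem_ker.1 (hle (by simpa using vsub_mem_vectorSpan ℝ hy h0D))
    have hvK : v ∈ K := by
      rw [← hKK]
      exact fun y hy => (hfD y hy).ge
    have hnvK : -v ∈ K := by
      rw [← hKK]
      exact fun y hy => by rw [dotProduct_neg, hfD y hy, neg_zero]
    have hv0 : v = 0 := hKpt v hvK hnvK
    exact hf0 (LinearMap.ext fun y => by rw [hfv, hv0, dotProduct_zero]; rfl)
  obtain ⟨y₀, hy₀⟩ := hint
  obtain ⟨ε, hε, hεa⟩ := dualCone_pointed_of_interior hy₀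
  rw [hKK] at hεa
  refine ⟨y₀, fun a ha => le_trans (by positivity) (hεa a ha), fun a ha h0 => ?_⟩
  have h := hεa a ha
  rw [h0] at h
  have : ‖a‖ ≤ 0 := by nlinarith [norm_nonneg a]
  exact norm_eq_zero.1 (le_antisymm this (norm_nonneg _))

/-! ### §3 Remark 20: the reduction to a pointed full-dimensional cone, for `(S^d_+)^m`-lifts with `m` free -/

/-- **`C` lifts ⇒ `C^*` lifts, any closed convex cone** (block size kept, number of blocks not).
Route (Remark 20): `Lin = C ∩ −C`, complement `M`, `C_1 = C ∩ M` (section), basis coordinates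
`ι : ℝ^m ≅ span C_1`, `K = ι⁻¹(C)` pointed full-dimensional closed convex with the lift of `C_1`; the tree's
`hasBlockPsdLift_dualCone` lifts `K^*`; `C^* = (ιᵀ)⁻¹(K^*) ∩ Lin^⊥`.
[cite: Averkov2019, Remark 20 (p08) and (2.2) (p06)] -/
theorem hasBlockPsdLift_dualCone_exists [DecidableEq V] {C : Set (V → ℝ)} {d r : ℕ} (hd : 1 ≤ d)
    (hC : HasBlockPsdLift C d r) (hCconv : Convex ℝ C) (hCclosed : IsClosed C) (h0 : (0 : V → ℝ) ∈ C)
    (hCsmul : ∀ x ∈ C, ∀ t : ℝ, 0 ≤ t → t • x ∈ C) :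
    HasBlockPsdLift (dualCone C) d (Fintype.card V + Fintype.card V + r) := by
  classical
  have hadd : ∀ x ∈ C, ∀ y ∈ C, x + y ∈ C := fun x hx y hy => add_mem_of_convex_cone hCconv hCsmul hx hy
  -- the lineality space and a linear complement
  let Lin : Submodule ℝ (V → ℝ) := lineality C hadd h0 hCsmul
  have hLin : ∀ x, x ∈ Lin ↔ x ∈ C ∧ -x ∈ C := fun x => Iff.rfl
  obtain ⟨M, hLM⟩ := Lin.exists_isCompl
  -- the pointed section `C₁ = C ∩ M` and its span `W₁`
  set C₁ : Set (V → ℝ) := C ∩ (M : Set (V → ℝ)) with hC₁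
  have hC₁lift : HasBlockPsdLift C₁ d r := hC.inter_affineSubspace M.toAffineSubspace
  let W₁ : Submodule ℝ (V → ℝ) := Submodule.span ℝ C₁
  have hW₁M : W₁ ≤ M := Submodule.span_le.2 Set.inter_subset_right
  -- coordinates `ι : ℝ^m ≅ W₁ ⊆ ℝ^V`, with a linear left inverse `c`
  let b := Module.finBasis ℝ W₁
  let ι : (Fin (Module.finrank ℝ W₁) → ℝ) →ₗ[ℝ] (V → ℝ) :=
    W₁.subtype ∘ₗ (b.equivFun.symm : (Fin (Module.finrank ℝ W₁) → ℝ) →ₗ[ℝ] W₁)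
  obtain ⟨g, hg⟩ := W₁.subtype.exists_leftInverse_of_injective W₁.ker_subtype
  have hg' : ∀ w : W₁, g (w : V → ℝ) = w := fun w => by
    have h := LinearMap.congr_fun hg w
    simpa using h
  let c : (V → ℝ) →ₗ[ℝ] (Fin (Module.finrank ℝ W₁) → ℝ) :=
    (b.equivFun : W₁ →ₗ[ℝ] (Fin (Module.finrank ℝ W₁) → ℝ)) ∘ₗ g
  have hιapp : ∀ a, ι a = ((b.equivFun.symm a : W₁) : V → ℝ) := fun a => rfl
  have hιmem : ∀ a, ι a ∈ W₁ := fun a => by rw [hιapp]; exact (b.equivFun.symm a).2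
  have hcι : ∀ a, c (ι a) = a := fun a => by
    show b.equivFun (g ((b.equivFun.symm a : W₁) : V → ℝ)) = a
    rw [hg', LinearEquiv.apply_symm_apply]
  have hιc : ∀ x ∈ W₁, ι (c x) = x := fun x hx => by
    have h1 : g x = ⟨x, hx⟩ := hg' ⟨x, hx⟩
    show ((b.equivFun.symm (b.equivFun (g x)) : W₁) : V → ℝ) = x
    rw [LinearEquiv.symm_apply_apply, h1]
  -- the model cone `K = ι⁻¹(C) ⊆ ℝ^m`
  set K : Set (Fin (Module.finrank ℝ W₁) → ℝ) := {a | ι a ∈ C} with hK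
  have hK_eq : K = c '' C₁ := by
    ext a
    constructor
    · intro ha
      exact ⟨ι a, ⟨ha, hW₁M (hιmem a)⟩, hcι a⟩
    · rintro ⟨x, hx, rfl⟩
      show ι (c x) ∈ C
      rw [hιc x (Submodule.subset_span hx)]
      exact hx.1
  have hKlift : HasBlockPsdLift K d r := by
    rw [hK_eq]
    exact hC₁lift.image c
  have hKclosed : IsClosed K := IsClosed.preimage ι.continuous_of_finiteDimensional hCclosed
  have hKconv : Convex ℝ K := by
    intro a ha a' ha' s t hs ht hst
    show ι (s • a + t • a') ∈ C
    rw [map_add, map_smul, map_smul]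
    exact hCconv ha ha' hs ht hst
  have hK0 : (0 : Fin (Module.finrank ℝ W₁) → ℝ) ∈ K := by
    show ι 0 ∈ C
    rw [map_zero]
    exact h0
  have hKsmul : ∀ a ∈ K, ∀ t : ℝ, 0 ≤ t → t • a ∈ K := fun a ha t ht => by
    show ι (t • a) ∈ C
    rw [map_smul]
    exact hCsmul _ ha t ht
  -- `K` is pointed: `K ∩ −K = 0` because `Lin ∩ M = 0` and `ι` is injective
  have hKpt : ∀ a ∈ K, -a ∈ K → a = 0 := fun a ha hna => by
    have h1 : ι a ∈ Lin := by
      rw [hLin]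
      refine ⟨ha, ?_⟩
      rw [← map_neg]
      exact hna
    have h2 : ι a ∈ M := hW₁M (hιmem a)
    have h3 : ι a = 0 := by
      have h := hLM.disjoint
      rw [Submodule.disjoint_def] at h
      exact h _ h1 h2
    have h4 := hcι a
    rw [h3, map_zero] at h4
    exact h4.symm
  have hKfp := exists_pointing_of_pointed hKconv hKclosed hK0 hKsmul hKpt
  -- `K` is full-dimensional: `span K = c(span C₁) = c(W₁) = ℝ^m`
  have hKint : (interior K).Nonempty := by
    rw [hKconv.interior_nonempty_iff_affineSpan_eq_top,
      AffineSubspace.affineSpan_eq_top_iff_vectorSpan_eq_top_of_nonempty ℝ (Fin (Module.finrank ℝ W₁) → ℝ)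
        (Fin (Module.finrank ℝ W₁) → ℝ) ⟨0, hK0⟩,
      eq_top_iff]
    have hspan : Submodule.span ℝ K = ⊤ := by
      rw [eq_top_iff]
      intro a _
      rw [hK_eq, Submodule.span_image]
      exact ⟨ι a, hιmem a, hcι a⟩
    rw [← hspan]
    exact Submodule.span_le.2 fun a ha => by simpa using vsub_mem_vectorSpan ℝ ha hK0
  -- the tree's theorem: `K^*` lifts with the same cone
  have hKdual : HasBlockPsdLift (dualCone K) d r := hasBlockPsdLift_dualCone hKlift hKclosed hKsmul hKfp hKint
  -- `C^* = (ιᵀ)⁻¹(K^*) ∩ Lin^⊥`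
  have hset : dualCone C = (adj ι) ⁻¹' (dualCone K) ∩ ((orth (Lin : Set (V → ℝ))).toAffineSubspace :
      Set (V → ℝ)) := by
    ext y
    constructor
    · intro hy
      refine ⟨fun a ha => ?_, fun l hl => ?_⟩
      · rw [← dotProduct_adj]
        exact hy _ ha
      · have hl' : l ∈ C ∧ -l ∈ C := (hLin l).1 hl
        have h1 := hy l hl'.1
        have h2 := hy (-l) hl'.2
        rw [neg_dotProduct] at h2
        linarith
    · rintro ⟨hy1, hy2⟩ x hx
      have hy2' : ∀ l ∈ Lin, l ⬝ᵥ y = 0 := hy2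
      have hx' : x ∈ Lin ⊔ M := by
        rw [hLM.sup_eq_top]
        exact Submodule.mem_top
      obtain ⟨l, hl, w, hw, hsum⟩ := Submodule.mem_sup.1 hx'
      have hl' : l ∈ C ∧ -l ∈ C := (hLin l).1 hl
      have hwC : w ∈ C := by
        have : w = x + -l := by rw [← hsum]; abel
        rw [this]
        exact hadd x hx (-l) hl'.2
      have hwW : w ∈ W₁ := Submodule.subset_span ⟨hwC, hw⟩
      have hcw : c w ∈ K := by
        show ι (c w) ∈ C
        rw [hιc w hwW]
        exact hwC
      have h1 : 0 ≤ c w ⬝ᵥ adj ι y := hy1 _ hcw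
      rw [← dotProduct_adj, hιc w hwW] at h1
      rw [← hsum, add_dotProduct, hy2' l hl, zero_add]
      exact h1
  rw [hset]
  exact (hasBlockPsdLift_preimage hKdual (adj ι) (hasBlockPsdLift_univ hd)).inter_affineSubspace _

end DualConeSxd

open DualConeSxd

/-- **Averkov 2019 (2.2), unconditionally: `C^*` has an `(S^d_+)^m`-lift for some `m` iff `C` does**, for every
closed convex cone `C ⊆ ℝ^V` and every block size `d ≥ 1` (Remark 20's reduction of the general case to the
pointed full-dimensional one, `hasBlockPsdLift_dualCone_iff`; the converse direction is the forward one for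
`C^*` and `(C^*)^* = C`). [cite: Averkov2019, (2.2) (p06), Remark 20 and Remark 21 (p08)] -/
theorem hasBlockPsdLift_dualCone_exists_iff [DecidableEq V] {C : Set (V → ℝ)} {d : ℕ} (hd : 1 ≤ d)
    (hCconv : Convex ℝ C) (hCclosed : IsClosed C) (h0 : (0 : V → ℝ) ∈ C)
    (hCsmul : ∀ x ∈ C, ∀ t : ℝ, 0 ≤ t → t • x ∈ C) :
    (∃ m, HasBlockPsdLift (dualCone C) d m) ↔ ∃ m, HasBlockPsdLift C d m := by
  constructor
  · rintro ⟨m, h⟩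
    have h' := hasBlockPsdLift_dualCone_exists hd h (convex_dualCone C) (isClosed_dualCone C)
      (fun x _ => by rw [dotProduct_zero]) (fun y hy t ht => smul_mem_dualCone hy ht)
    rw [dualCone_dualCone hCconv hCclosed h0 hCsmul] at h'
    exact ⟨_, h'⟩
  · rintro ⟨m, h⟩
    exact ⟨_, hasBlockPsdLift_dualCone_exists hd h hCconv hCclosed h0 hCsmul⟩

/-- The feasible block sizes (`≥ 1`) of `C` and of `C^*` coincide, for every closed convex cone.
[cite: Averkov2019, (2.2) (p06) and Remark 20 (p08)] -/
theorem setOf_blockSize_dualCone_eq [DecidableEq V] {C : Set (V → ℝ)} (hCconv : Convex ℝ C)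
    (hCclosed : IsClosed C) (h0 : (0 : V → ℝ) ∈ C) (hCsmul : ∀ x ∈ C, ∀ t : ℝ, 0 ≤ t → t • x ∈ C) :
    {d | 1 ≤ d ∧ ∃ m, HasBlockPsdLift (dualCone C) d m} = {d | 1 ≤ d ∧ ∃ m, HasBlockPsdLift C d m} := by
  ext d
  simp only [Set.mem_setOf_eq]
  exact ⟨fun ⟨hd, h⟩ => ⟨hd, (hasBlockPsdLift_dualCone_exists_iff hd hCconv hCclosed h0 hCsmul).1 h⟩,
    fun ⟨hd, h⟩ => ⟨hd, (hasBlockPsdLift_dualCone_exists_iff hd hCconv hCclosed h0 hCsmul).2 h⟩⟩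

/-- **Averkov 2019, (2.2): `sxd(C^*) = sxd(C)` for every closed convex cone `C`** — `d₀ ≥ 1` is the least
feasible block size (LMI size) of `C^*` iff it is that of `C` (the tree states `sxd` values as `IsLeast`; sizes
are positive integers, "LMI of size `k`", `k` positive, p03). Printed under "`n`-dimensional pointed" (p06) and
extended by Remark 20 (p08); here for all closed convex cones of `ℝ^V`.
[cite: Averkov2019, (2.2) (p06), Remark 20–21 (p08), Def. 1 (p03)] -/
theorem Averkov2019_sxd_dual [DecidableEq V] {C : Set (V → ℝ)} (hCconv : Convex ℝ C) (hCclosed : IsClosed C)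
    (h0 : (0 : V → ℝ) ∈ C) (hCsmul : ∀ x ∈ C, ∀ t : ℝ, 0 ≤ t → t • x ∈ C) (d₀ : ℕ) :
    IsLeast {d | 1 ≤ d ∧ ∃ m, HasBlockPsdLift (dualCone C) d m} d₀ ↔
      IsLeast {d | 1 ≤ d ∧ ∃ m, HasBlockPsdLift C d m} d₀ := by
  rw [setOf_blockSize_dualCone_eq hCconv hCclosed h0 hCsmul]


/-! ### §4 The number of blocks does not transfer in general: (2.1) needs "pointed, full-dimensional" -/

/-- **Scope of (2.1)** ("if `C ⊆ ℝ^n` is an `n`-dimensional pointed closed convex cone", p06): without these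
hypotheses the same-cone transfer fails already in `ℝ¹` — the closed convex cone `{0}` has an `(S^1_+)^1`-lift,
its dual `{0}^* = ℝ¹` has none (an `(S^1_+)^1`-lifted set is a point or a ray). So only the block SIZE statement
(2.2) survives for general cones (`hasBlockPsdLift_dualCone_exists_iff`). [cite: Averkov2019, (2.1)–(2.2) (p06)] -/
theorem not_hasBlockPsdLift_dualCone_zero_one_one :
    HasBlockPsdLift ({0} : Set (Fin 1 → ℝ)) 1 1 ∧ ¬ HasBlockPsdLift (dualCone ({0} : Set (Fin 1 → ℝ))) 1 1 := by
  refine ⟨hasBlockPsdLift_singleton _ le_rfl le_rfl, ?_⟩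
  have hdual : dualCone ({0} : Set (Fin 1 → ℝ)) = Set.univ :=
    Set.eq_univ_of_forall fun y x hx => by rw [Set.mem_singleton_iff.1 hx, zero_dotProduct]
  rw [hdual]
  rintro ⟨L, π, huniv⟩
  -- every block tuple `M` is `(M 0 0 0) •` the all-ones tuple, so the image is contained in a ray
  let E : Fin 1 → Matrix (Fin 1) (Fin 1) ℝ := fun _ => Matrix.of fun _ _ => 1
  have hM : ∀ M : Fin 1 → Matrix (Fin 1) (Fin 1) ℝ, M = M 0 0 0 • E := fun M => by
    funext t; ext i j
    have ht : t = 0 := Subsingleton.elim _ _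
    have hi : i = 0 := Subsingleton.elim _ _
    have hj : j = 0 := Subsingleton.elim _ _
    subst ht; subst hi; subst hj
    simp [E]
  set s : ℝ := π E 0 with hs
  -- the image has `0`-th coordinate of the sign of `s`; pick the point of the opposite sign
  let x₀ : Fin 1 → ℝ := fun _ => if 0 ≤ s then -1 else 1
  have hx₀ : x₀ ∈ (Set.univ : Set (Fin 1 → ℝ)) := trivial
  rw [huniv] at hx₀
  obtain ⟨M, ⟨hMpsd, -⟩, hMx⟩ := hx₀
  have ht0 : 0 ≤ M 0 0 0 := (hMpsd 0).diag_nonneg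
  have hπ : π M = M 0 0 0 • π E := by
    conv_lhs => rw [hM M]
    rw [map_smul]
  have hcoord : x₀ 0 = M 0 0 0 * s := by
    rw [← hMx, hπ, Pi.smul_apply, smul_eq_mul]
  by_cases h0s : 0 ≤ s
  · have h1 : x₀ 0 = -1 := by simp [x₀, h0s]
    rw [h1] at hcoord
    nlinarith [mul_nonneg ht0 h0s]
  · have h1 : x₀ 0 = 1 := by simp [x₀, h0s]
    rw [h1] at hcoord
    have hs0 : 0 ≤ -s := by linarith [not_le.1 h0s]
    nlinarith [mul_nonneg ht0 hs0]


/-! ### §5 Erratum: Theorem 19 as printed fails for non-pointed cones (fixed `K`) -/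

/-- **ERRATUM (Averkov 2019, Thm. 19 as printed).** p08, verbatim: "Theorem 19 (Gouveia et al.). Let `C ⊆ ℝⁿ` be a
closed convex cone and let `K = (S^k_+)^m`. Then the following conditions are equivalent: (i) `C` has a
`K`-lift. (ii) For every `x ∈ C` there exist `A_x ∈ K` and for every `y ∈ C^*` there exists `B_y ∈ K` such that
the equality `⟨x, y⟩ = ⟨A_x, B_y⟩` holds for all `x ∈ C` and `y ∈ C^*`." For the NON-POINTED closed convex cone
`C = ℝ¹` (`n = k = m = 1`): `C^* = {0}`, so (ii) holds with `A_x = B_y = 0`, while `ℝ¹` has no `(S^1_+)^1`-lift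
((i) fails; an `(S^1_+)^1`-lifted set is a point or a ray). Hence (ii) ⇒ (i) is false as printed; Remark 20's
"`C` has a `K`-lift if and only if `C_0` has a `K`-lift" fails the same way for `C = C_0 × ℝ^s` with `K` fixed.
Correct readings: `C` pointed (Remark 20's case `s = 0`, covered by [GPT:2013] as the remark says), or `K =
(S^k_+)^{m'}` with `m'` free — which is all that (2.2) uses (`hasBlockPsdLift_dualCone_exists_iff`).
[cite: Averkov2019, Thm. 19 and Remark 20 (p08)] -/
theorem Averkov2019_thm19_ii_not_imp_i :
    ∃ C : Set (Fin 1 → ℝ), IsClosed C ∧ Convex ℝ C ∧ (0 : Fin 1 → ℝ) ∈ C ∧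
      (∀ x ∈ C, ∀ t : ℝ, 0 ≤ t → t • x ∈ C) ∧
      -- (ii) for `K = (S^1_+)^1`: families `A_x, B_y ∈ K` with `⟨x, y⟩ = ⟨A_x, B_y⟩ = Σ_t tr(A_x(t) B_y(t))`
      (∃ (A : (Fin 1 → ℝ) → (Fin 1 → Matrix (Fin 1) (Fin 1) ℝ))
          (B : (Fin 1 → ℝ) → (Fin 1 → Matrix (Fin 1) (Fin 1) ℝ)),
        (∀ x ∈ C, ∀ t, (A x t).PosSemidef) ∧ (∀ y ∈ dualCone C, ∀ t, (B y t).PosSemidef) ∧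
        ∀ x ∈ C, ∀ y ∈ dualCone C, x ⬝ᵥ y = ∑ t, (A x t * B y t).trace) ∧
      -- (i) fails for `K = (S^1_+)^1`
      ¬ HasBlockPsdLift C 1 1 := by
  have hdual0 : dualCone ({0} : Set (Fin 1 → ℝ)) = Set.univ :=
    Set.eq_univ_of_forall fun y x hx => by rw [Set.mem_singleton_iff.1 hx, zero_dotProduct]
  have hdualU : dualCone (Set.univ : Set (Fin 1 → ℝ)) = {0} := by
    rw [← hdual0, dualCone_dualCone (convex_singleton 0) isClosed_singleton rfl
      (fun x hx t _ => by rw [Set.mem_singleton_iff.1 hx, smul_zero]; rfl)]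
  refine ⟨Set.univ, isClosed_univ, convex_univ, trivial, fun _ _ _ _ => trivial,
    ⟨fun _ _ => 0, fun _ _ => 0, fun _ _ _ => PosSemidef.zero, fun _ _ _ => PosSemidef.zero, fun x _ y hy => ?_⟩, ?_⟩
  · rw [hdualU, Set.mem_singleton_iff] at hy
    rw [hy, dotProduct_zero]
    simp
  · rw [← hdual0]
    exact not_hasBlockPsdLift_dualCone_zero_one_one.2

end Literature.Combinatorics.Optimization
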